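import Summits.HodgeConjecture.HodgeConjecture.Theorems.Ring2WeilCoverageNormClassEq
import Summits.HodgeConjecture.HodgeConjecture.Theorems.Ring2WeilCoverageNormTableC
import HarnessLib

/-!
# Weil-type family coverage — product windows, part T: a second member on `W6.2.35` and the FIRST curve-carried member on `W6.7.17 = (3, ℚ(√-7), [17])` (`PSL₂(7) × S₁₇`)

research route conditional on HC_CM; not a corollary; Q11.4-sentence-2 already refuted in dim ≥ 3.

Ring 2, WEIL-TYPE FAMILY-COVERAGE CENSUS (`HOME/WEIL-FAMILY-COVERAGE.md` `## b04`, block b04.15 P.S. 6, owner ring2-b04, gen 51); twentieth part of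
`Ring2WeilCoverageProductWindow` (same conventions as parts L–S; generic carrier scan `symwin.py gscan`, random realisation, engine `bigwin.py`).
§1 the second rigid `GL₂(3) × S₃₅` datum `(3:3¹¹.2, 2:2¹⁶.1³, 8a:8³.4².3)` on `W6.2.35` (kit j206873; 840 sheets, `Y` genus 24): `det H = -1/1680`,
`T = {5,7}`, class `[35]`.  §2 **the FIRST curve-carried `(3,3)` member on `W6.7.17 = (3, ℚ(√-7), [17])`** (pub-hsemireg R4, `ℚ(√-7)`, `a = 17`):
the rigid datum `(2:2⁸.1, 3:3⁵.2, 7a:7.5.4.1)` of the window `PSL₂(7) × S₁₇` (carrier `L27c`: `PSL₂(7)` on the Fano plane, `λ` of degree 3,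
`H₁ = C₃`; kit j206877, `56·17 = 952` sheets, `Y` genus 49, Galois closure of genus 9 745 835 529 830 401): `det H = -1163/852992`, `T = {7,17}`,
class `[17]` = THEOREM S7's `[n]^{r₁}` (`r₁ = 1`; `S_in(PSL₂(7), λ) = ∅`).

No `def`, no named fact, no `sorry`; nothing here is a statement about Hodge classes; `HC_CM` is used nowhere.
References: [cite: vanGeemen1994HodgeAV, (5.4.1), Lemma 5.2]; [cite: Serre1973, Ch. III §1].
-/

set_option linter.dupNamespace false

open Literature.AlgebraicGeometry.Motives
open Literature.AlgebraicGeometry.VanGeemen1994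
open Summit.HodgeConjecture.HodgeConjecture.Ring2.Hypotheses

namespace Summit.HodgeConjecture.HodgeConjecture.Ring2.WeilCoverage

/-- FIBRE-PRODUCT datum `GL23xS35` `(0; 3:3^11.2,2:2^16.1^3,8a:8^3.4^2.3)` (cycle types in `S35`; Hurwitz dimension 0; realised by explicit permutations with product one, generation: 2-transitive + Jordan (a 2-cycle as the 3-th power of a branch cycle, 2 <= n-3) => monodromy >= A_35): `Y = D ×_{ℙ¹} X` (genus 24; `D` the `GL23`-quotient datum = the CM elliptic curve, `X` the degree-35 cover, genus 0), computed on its 840 sheets (engine `bigwin.py`, exact); the HIDDEN FACTOR `B` = the `λ`-part of the Prym `P(Y/D)` — an abelian SIXFOLD with `(3,3)` `ℚ(√-2)`-action, WEIL TYPE — has literal `det H|_B = -1/1680`, `a = 1/1680`, `T(a) = [5, 7]`: row `W6.2.35` (NON-split); `r₁ = dim_K H¹(D)_λ = 1`, `r_H = 7`. THEOREM S8 (Prym form of the product-window law, census b04.15 (A): `[a_B] = [n]^{r₁}`, no 2-transitivity needed) predicts `T(a_B) = [5, 7]` from `r₁ = 1`, `n = 35` — CONFIRMED.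
research route conditional on HC_CM; not a corollary; Q11.4-sentence-2 already refuted in dim ≥ 3. [cite: vanGeemen1994HodgeAV, (5.4.1)] -/
theorem fibre2_GL23S35_n35_e1c03b_mk_detH_ne_split :
    (QuotientGroup.mk (Units.mk0 (((-1 : ℚ) / 1680)) (by norm_num)) : weilNormResidueGroup 2) ≠
      splitDiscriminantClass 3 2 := by
  have e : Units.mk0 (((-1 : ℚ) / 1680)) (by norm_num) = -(Units.mk0 ((1 : ℚ) / 1680) (by norm_num)) := Units.ext (by norm_num)
  rw [Ne, e, mk_neg_eq_splitDiscriminantClass_iff_of_odd (n := 3) (by decide)]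
  have h := mul_not_mem_normUnitsSubgroup (mem_normUnitsSubgroup_of_sq_add_mul_sq (d := 2) (a := ((1 : ℚ) / 58800)) (by norm_num) ((1 : ℚ) / 420) ((1 : ℚ) / 420) (by norm_num))
    Summit.HodgeConjecture.HodgeConjecture.Ring2.WeilCoverage.SqrtNeg2.not_mem_35
  rw [mk0_mul_mk0] at h
  norm_num at h
  exact h

/-- The same datum, CELL IDENTIFICATION: `[det H|_B] = [-35]` in `ℚˣ/Nm(ℚ(√-2)ˣ)` — the census ROW KEY of `W6.2.35` (`a·35 = ((1 : ℚ) / 48) = (((1 : ℚ) / 12))² + 2·(((1 : ℚ) / 12))²`).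
research route conditional on HC_CM; not a corollary; Q11.4-sentence-2 already refuted in dim ≥ 3. [cite: vanGeemen1994HodgeAV, Lemma 5.2 (3)] -/
theorem fibre2_GL23S35_n35_e1c03b_mk_detH_eq_key :
    (QuotientGroup.mk (Units.mk0 (-(((1 : ℚ) / 1680))) (neg_ne_zero.2 (by norm_num))) : weilNormResidueGroup 2) =
      QuotientGroup.mk (Units.mk0 (-(35 : ℚ)) (neg_ne_zero.2 (by norm_num))) :=
  mk_neg_eq_mk_neg_of_mul_mem (by norm_num) (by norm_num)
    (mem_normUnitsSubgroup_of_sq_add_mul_sq _ ((1 : ℚ) / 12) ((1 : ℚ) / 12) (by norm_num))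

/-- FIBRE-PRODUCT datum `L27cxS17` `(0; 2:2^8.1,3:3^5.2,7a:7.5.4.1)` (cycle types in `S17`; Hurwitz dimension 0; realised by explicit permutations with product one, generation: 2-transitive + Jordan (a 2-cycle as the 3-th power of a branch cycle, 2 <= n-3) => monodromy >= A_17): `Y = D ×_{ℙ¹} X` (genus 49; `D` the `L27c`-quotient datum = the CM elliptic curve, `X` the degree-17 cover, genus 0), computed on its 952 sheets (engine `bigwin.py`, exact); the HIDDEN FACTOR `B` = the `λ`-part of the Prym `P(Y/D)` — an abelian SIXFOLD with `(3,3)` `ℚ(√-7)`-action, WEIL TYPE — has literal `det H|_B = -1163/852992`, `a = 1163/852992`, `T(a) = [7, 17]`: row `W6.7.17` (NON-split); `r₁ = dim_K H¹(D)_λ = 1`, `r_H = 7`. THEOREM S8 (Prym form of the product-window law, census b04.15 (A): `[a_B] = [n]^{r₁}`, no 2-transitivity needed) predicts `T(a_B) = [7, 17]` from `r₁ = 1`, `n = 17` — CONFIRMED.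
research route conditional on HC_CM; not a corollary; Q11.4-sentence-2 already refuted in dim ≥ 3. [cite: vanGeemen1994HodgeAV, (5.4.1)] -/
theorem fibre7_L27cS17_n17_39c8c0_mk_detH_ne_split :
    (QuotientGroup.mk (Units.mk0 (((-1163 : ℚ) / 852992)) (by norm_num)) : weilNormResidueGroup 7) ≠
      splitDiscriminantClass 3 7 := by
  have e : Units.mk0 (((-1163 : ℚ) / 852992)) (by norm_num) = -(Units.mk0 ((1163 : ℚ) / 852992) (by norm_num)) := Units.ext (by norm_num)
  rw [Ne, e, mk_neg_eq_splitDiscriminantClass_iff_of_odd (n := 3) (by decide)]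
  have h := mul_not_mem_normUnitsSubgroup (mem_normUnitsSubgroup_of_sq_add_mul_sq (d := 7) (a := ((1163 : ℚ) / 14500864)) (by norm_num) ((1 : ℚ) / 112) ((1 : ℚ) / 3808) (by norm_num))
    Summit.HodgeConjecture.HodgeConjecture.Ring2.WeilCoverage.SqrtNeg7.not_mem_17
  rw [mk0_mul_mk0] at h
  norm_num at h
  exact h

/-- The same datum, CELL IDENTIFICATION: `[det H|_B] = [-17]` in `ℚˣ/Nm(ℚ(√-7)ˣ)` — the census ROW KEY of `W6.7.17` (`a·17 = ((1163 : ℚ) / 50176) = (((17 : ℚ) / 112))² + 7·(((1 : ℚ) / 224))²`).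
research route conditional on HC_CM; not a corollary; Q11.4-sentence-2 already refuted in dim ≥ 3. [cite: vanGeemen1994HodgeAV, Lemma 5.2 (3)] -/
theorem fibre7_L27cS17_n17_39c8c0_mk_detH_eq_key :
    (QuotientGroup.mk (Units.mk0 (-(((1163 : ℚ) / 852992))) (neg_ne_zero.2 (by norm_num))) : weilNormResidueGroup 7) =
      QuotientGroup.mk (Units.mk0 (-(17 : ℚ)) (neg_ne_zero.2 (by norm_num))) :=
  mk_neg_eq_mk_neg_of_mul_mem (by norm_num) (by norm_num)
    (mem_normUnitsSubgroup_of_sq_add_mul_sq _ ((17 : ℚ) / 112) ((1 : ℚ) / 224) (by norm_num))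

end Summit.HodgeConjecture.HodgeConjecture.Ring2.WeilCoverage
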